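import Summits.NavierStokesRegularity.FunctionalMining.NoGo.ConjectureSRefutation
import Summits.NavierStokesRegularity.FunctionalMining.NoGo.SpiralJetKillAll
import HarnessLib

/-!
# CONJECTURE S⁻(m) decided for every `m`: true iff `m = 1` (kernel)

Search for candidate a priori estimates; no regularity claim. NS FUNCTIONAL MINING — NO-GO BRANCH
(cell `pub-nsfunc`, prove seat gen 14). `NoGo/ConjectureS` names CONJECTURE S⁻(m)
(`FeasibleStretchingNonpos hd m`: every smooth divergence-free field on `T³` with middle strain
eigenvalue `≤ 0` everywhere has `2m ∫ |ω|^{2(m−1)} σ ≤ 0`); `m = 1` is a theorem (Betchov–Miller),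
`m = 2, 3` were refuted by the explicit kill-all field `KillAll.fld` (`NoGo/ConjectureSRefutation`). The
spiral-jet witness of gen 13 (`SpiralJet.sfld`: `λ₂ ≡ 0`, `∫(|ω|²)^rσ > 0` for EVERY real `r > 0`,
`SpiralJet.integral_moment_pos`) refutes S⁻(m) for every `m ≥ 2` at once
(`not_feasibleStretchingNonpos_of_two_le`), so the named conjecture is classified:
`FeasibleStretchingNonpos hd m ↔ m = 1` for `m ≥ 1` (`feasibleStretchingNonpos_iff_eq_one`). Static
facts about explicit fields; nothing about Navier–Stokes regularity is asserted.
-/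

noncomputable section

open MeasureTheory

namespace Summit.NavierStokesRegularity.FunctionalMining

open Literature.Analysis Literature.Analysis.FluidPDE Literature.Analysis.FunctionSpaces
  Literature.Analysis.FunctionSpaces.Torus

/-- **CONJECTURE S⁻(m) is false for every `m ≥ 2`**: the spiral jet has `λ₂ ≤ 0` everywhere and
`2m∫|ω|^{2(m−1)}σ > 0` (`SpiralJet.integral_moment_pos` at `r = m − 1 > 0`). Search for candidate a
priori estimates; no regularity claim. [ours] -/
theorem not_feasibleStretchingNonpos_of_two_le (hd : Fintype.card (Fin 3) = 3) {m : ℕ} (hm : 2 ≤ m) :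
    ¬ FeasibleStretchingNonpos hd m := by
  rw [not_feasibleStretchingNonpos_iff]
  refine ⟨SpiralJet.sfld, SpiralJet.isSmooth_sfld, SpiralJet.isDivFree_sfld,
    SpiralJet.middle_nonpos_sfld, ?_⟩
  have hr : (0 : ℝ) < ((m - 1 : ℕ) : ℝ) := by
    have : 1 ≤ m - 1 := by omega
    exact_mod_cast this
  have h := SpiralJet.integral_moment_pos hr
  have e : (fun ξ : UnitAddTorus (Fin 3) =>
      torusVorticitySqAt SpiralJet.sfld ξ ^ (m - 1) * torusStretchingDensity SpiralJet.sfld ξ) =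
      fun ξ => torusVorticitySqAt SpiralJet.sfld ξ ^ ((m - 1 : ℕ) : ℝ) *
        torusStretchingDensity SpiralJet.sfld ξ := by
    funext ξ
    rw [Real.rpow_natCast]
  rw [e]
  have hm0 : (0 : ℝ) < 2 * (m : ℝ) := by
    have : (2 : ℝ) ≤ m := by exact_mod_cast hm
    linarith
  exact mul_pos hm0 h

/-- **CONJECTURE S⁻ classified (kernel): for `m ≥ 1`, S⁻(m) holds iff `m = 1`.** Search for
candidate a priori estimates; no regularity claim. [ours] -/
theorem feasibleStretchingNonpos_iff_eq_one (hd : Fintype.card (Fin 3) = 3) {m : ℕ} (hm : 1 ≤ m) :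
    FeasibleStretchingNonpos hd m ↔ m = 1 := by
  refine ⟨fun h => ?_, fun h => by subst h; exact feasibleStretchingNonpos_one hd⟩
  by_contra hne
  exact not_feasibleStretchingNonpos_of_two_le hd (by omega) h

/-- Binder-free instance at `m = 4` (the audit reads it as a refutation of the named conjecture). [ours] -/
theorem feasibleStretchingNonpos_four_false :
    ¬ FeasibleStretchingNonpos (d := Fin 3) (Fintype.card_fin 3) 4 :=
  not_feasibleStretchingNonpos_of_two_le _ (by norm_num)

end Summit.NavierStokesRegularity.FunctionalMining

end
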